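import Literature.NumberTheory.Sieve.RamanujanSum
import Literature.NumberTheory.Sieve.VinogradovExpSumTools
import Literature.NumberTheory.Sieve.TwistedWeightMellin
import HarnessLib

/-!
# The discrete circle method on `ℤ/N₀` and the positive model for the endgame

Topic `Literature/NumberTheory/Sieve`; a PROVED tool file toward
`Literature.NumberTheory.DiophantineGeometry.XYZUpperHalf` ([Harper2016, Cor. 1], §5, in the
smooth-weighted, discrete form used in the tree). Contents:

* `circle_identity`: for `f, g` supported on `2n ≤ N₀` and any `k`,
  `∑_{r mod N₀} F(r/N₀) G(r/N₀) conj K(r/N₀) = N₀ ∑_{a,b} f(a) g(b) conj k(a+b)`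
  (`F(θ) = ∑_{1≤a≤N₀} f(a)e(aθ)`, …), i.e. additive counting by orthogonality on `ℤ/N₀`;
* `norm_sum_mul_fourierChar_le_variation`: Abel summation —
  `‖∑_{n=1}^{N} c_n e(nθ)‖ ≤ (|c_N| + ∑_{n<N} |c_{n+1} − c_n|)/(2‖θ‖)` for real `c`;
* the positive model weights `m_n = (𝓜/x) (n/x)^{α+1} (1 − n/x)²` (`modelWeight`) with
  `0 ≤ m_n ≤ 𝓜/x`, their exponential sum `M(θ)` (`modelSum`), `M(θ) ≪ 𝓜/(x‖θ‖)`
  (`norm_modelSum_le`) and the comparison with `𝓜 Ŵ_λ(α)` at `θ = λ/x`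
  (`norm_modelSum_sub_main_le`, by comparing the sum with `x ∫₀¹ v^{α+1}(1−v)² e(λv) dv`).

## References

* A. J. Harper, Compositio Math. 152 (2016), §5 [Harper2016].
* H. L. Montgomery, R. C. Vaughan, *Multiplicative Number Theory I*, §4.1 (orthogonality) [MontgomeryVaughan2007].
-/

noncomputable section

open Finset Real Complex MeasureTheory
open scoped FourierTransform ComplexConjugate

namespace Literature.NumberTheory.Sieve

namespace Endgame

open RamanujanSum Vinogradov TwistedWeight

/-! ### Orthogonality on `ℤ/N₀` -/

/-- `conj e(t) = e(−t)` (a private copy of `MauduitRivat.conj_coe_fourierChar`, not imported to keep the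
import closure small). [folklore] -/
private theorem conj_fourierChar (t : ℝ) : conj (𝐞 t : ℂ) = (𝐞 (-t) : ℂ) := by
  rw [← Circle.coe_inv_eq_conj, AddChar.map_neg_eq_inv]

/-- `∑_{r mod N₀} e((a+b−c) r/N₀) = N₀ [N₀ ∣ a+b−c]`. [cite: MontgomeryVaughan2007, §4.1 (4.6)] -/
theorem sum_fourierChar_triple {N₀ : ℕ} (hN : N₀ ≠ 0) (a b c : ℕ) :
    ∑ r ∈ range N₀, (𝐞 ((a : ℝ) * r / N₀) : ℂ) * (𝐞 ((b : ℝ) * r / N₀) : ℂ) * conj (𝐞 ((c : ℝ) * r / N₀) : ℂ) =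
      if (N₀ : ℤ) ∣ ((a : ℤ) + b - c) then (N₀ : ℂ) else 0 := by
  rw [← sum_range_fourierChar_div hN ((a : ℤ) + b - c)]
  refine Finset.sum_congr rfl fun r _ => ?_
  rw [conj_fourierChar, ← Circle.coe_mul, ← Circle.coe_mul, ← AddChar.map_add_eq_mul, ← AddChar.map_add_eq_mul]
  congr 2
  push_cast; ring

/-- **Additive counting by orthogonality on `ℤ/N₀`.** For `f, g` vanishing when `2n > N₀` and any `k`:
`∑_{r mod N₀} F(r/N₀) G(r/N₀) conj(K(r/N₀)) = N₀ ∑_{1≤a,b≤N₀} f(a) g(b) conj(k(a+b))`.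
[cite: Harper2016, §5] [cite: MontgomeryVaughan2007, §4.1] -/
theorem circle_identity {N₀ : ℕ} (hN : N₀ ≠ 0) (f g k : ℕ → ℂ)
    (hf : ∀ a, N₀ < 2 * a → f a = 0) (hg : ∀ b, N₀ < 2 * b → g b = 0) :
    ∑ r ∈ range N₀, (∑ a ∈ Icc 1 N₀, f a * (𝐞 ((a : ℝ) * r / N₀) : ℂ)) *
        (∑ b ∈ Icc 1 N₀, g b * (𝐞 ((b : ℝ) * r / N₀) : ℂ)) *
        conj (∑ c ∈ Icc 1 N₀, k c * (𝐞 ((c : ℝ) * r / N₀) : ℂ)) =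
      (N₀ : ℂ) * ∑ a ∈ Icc 1 N₀, ∑ b ∈ Icc 1 N₀, f a * g b * conj (k (a + b)) := by
  -- expand the triple product and swap with the sum over `r`
  have hexp : ∀ r : ℕ, (∑ a ∈ Icc 1 N₀, f a * (𝐞 ((a : ℝ) * r / N₀) : ℂ)) *
      (∑ b ∈ Icc 1 N₀, g b * (𝐞 ((b : ℝ) * r / N₀) : ℂ)) *
      conj (∑ c ∈ Icc 1 N₀, k c * (𝐞 ((c : ℝ) * r / N₀) : ℂ)) =
      ∑ a ∈ Icc 1 N₀, ∑ b ∈ Icc 1 N₀, ∑ c ∈ Icc 1 N₀, f a * g b * conj (k c) *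
        ((𝐞 ((a : ℝ) * r / N₀) : ℂ) * (𝐞 ((b : ℝ) * r / N₀) : ℂ) * conj (𝐞 ((c : ℝ) * r / N₀) : ℂ)) := by
    intro r
    rw [map_sum, Finset.sum_mul_sum, Finset.sum_mul]
    refine Finset.sum_congr rfl fun a _ => ?_
    rw [Finset.sum_mul]
    refine Finset.sum_congr rfl fun b _ => ?_
    rw [Finset.mul_sum]
    refine Finset.sum_congr rfl fun c _ => ?_
    rw [map_mul]; ring
  simp_rw [hexp]
  rw [Finset.sum_comm]
  rw [Finset.mul_sum]
  refine Finset.sum_congr rfl fun a ha => ?_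
  rw [Finset.sum_comm, Finset.mul_sum]
  refine Finset.sum_congr rfl fun b hb => ?_
  rw [Finset.sum_comm]
  simp_rw [← Finset.mul_sum, sum_fourierChar_triple hN]
  -- now `∑_c f g conj(k c) N₀ [N₀ ∣ a+b−c] = N₀ f g conj(k(a+b))`
  by_cases hfg : f a * g b = 0
  · rw [hfg, zero_mul, mul_zero]
    refine Finset.sum_eq_zero fun c _ => ?_
    ring
  · have ha2 : 2 * a ≤ N₀ := by by_contra h; exact hfg (by rw [hf a (not_le.mp h), zero_mul])
    have hb2 : 2 * b ≤ N₀ := by by_contra h; exact hfg (by rw [hg b (not_le.mp h), mul_zero])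
    have ha1 := (Finset.mem_Icc.mp ha).1
    have hb1 := (Finset.mem_Icc.mp hb).1
    have hab : a + b ∈ Icc 1 N₀ := Finset.mem_Icc.mpr ⟨by omega, by omega⟩
    have hdvd : ∀ c ∈ Icc 1 N₀, ((N₀ : ℤ) ∣ ((a : ℤ) + b - c) ↔ c = a + b) := by
      intro c hc
      obtain ⟨hc1, hcN⟩ := Finset.mem_Icc.mp hc
      constructor
      · rintro ⟨m, hm⟩
        have h1 : |((a : ℤ) + b - c)| < N₀ := by rw [abs_lt]; constructor <;> omega
        rw [hm, abs_mul, Nat.abs_cast] at h1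
        have : |m| < 1 := by
          by_contra h2; push Not at h2
          have := mul_le_mul_of_nonneg_left h2 (Nat.cast_nonneg N₀ : (0 : ℤ) ≤ N₀)
          rw [mul_one] at this; omega
        have hm0 : m = 0 := by
          rcases abs_lt.mp this with ⟨h3, h4⟩; omega
        rw [hm0, mul_zero] at hm
        omega
      · rintro rfl; exact ⟨0, by push_cast; ring⟩
    rw [Finset.sum_congr rfl fun c hc => by rw [if_congr (hdvd c hc) rfl rfl]]
    simp_rw [mul_ite, mul_zero]
    rw [Finset.sum_ite_eq' (Icc 1 N₀) (a + b) (fun c => f a * g b * conj (k c) * (N₀ : ℂ)), if_pos hab]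
    ring

/-! ### Abel summation -/

/-- **Abel summation for real weights.** For `c : ℕ → ℝ` and `N ≥ 1`:
`‖∑_{n=1}^{N} c_n e(nθ)‖ (2‖θ‖) ≤ |c_N| + ∑_{n=1}^{N−1} |c_{n+1} − c_n|`. [folklore] -/
theorem norm_sum_mul_fourierChar_mul_distInt_le (c : ℕ → ℝ) (N : ℕ) (θ : ℝ) :
    ‖∑ n ∈ Icc 1 N, (c n : ℂ) * (𝐞 (n * θ) : ℂ)‖ * (2 * distInt θ) ≤
      |c N| + ∑ n ∈ Ico 1 N, |c (n + 1) - c n| := by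
  rcases Nat.eq_zero_or_pos N with rfl | hN
  · simp
  -- write the sum over `Icc 1 N` as a sum over `range N` of `c(i+1) e((i+1)θ)`
  have hshift : ∑ n ∈ Icc 1 N, (c n : ℂ) * (𝐞 (n * θ) : ℂ) =
      ∑ i ∈ range N, (c (i + 1) : ℂ) • (𝐞 (((i + 1 : ℕ) : ℝ) * θ) : ℂ) := by
    refine Finset.sum_nbij' (fun n => n - 1) (fun i => i + 1) ?_ ?_ ?_ ?_ ?_
    · intro n hn; have := Finset.mem_Icc.mp hn; exact Finset.mem_range.mpr (by omega)
    · intro i hi; have := Finset.mem_range.mp hi; exact Finset.mem_Icc.mpr ⟨by omega, by omega⟩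
    · intro n hn; have := Finset.mem_Icc.mp hn; omega
    · intro i _; omega
    · intro n hn
      have := Finset.mem_Icc.mp hn
      rw [smul_eq_mul, Nat.sub_add_cancel this.1]
  rw [hshift, Finset.sum_range_by_parts]
  -- partial sums `G i = ∑_{j<i} e((j+1)θ) = ∑_{m ∈ Ioc 0 i} e(mθ)`
  set G : ℕ → ℂ := fun i => ∑ j ∈ range i, (𝐞 (((j + 1 : ℕ) : ℝ) * θ) : ℂ) with hG
  have hGle : ∀ i, ‖G i‖ * distInt θ ≤ 1 / 2 := by
    intro i
    have h1 : G i = ∑ m ∈ Ioc 0 i, (𝐞 (((m : ℕ) : ℝ) * θ) : ℂ) := by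
      simp only [hG]
      refine Finset.sum_nbij' (fun j => j + 1) (fun m => m - 1) ?_ ?_ ?_ ?_ ?_
      · intro j hj; have := Finset.mem_range.mp hj; exact Finset.mem_Ioc.mpr ⟨by omega, by omega⟩
      · intro m hm; have := Finset.mem_Ioc.mp hm; exact Finset.mem_range.mpr (by omega)
      · intro j _; omega
      · intro m hm; have := Finset.mem_Ioc.mp hm; omega
      · intro j _; rfl
    rw [h1]
    exact norm_sum_Ioc_fourierChar_mul_distInt_le 0 i θ
  have hd0 : 0 ≤ distInt θ := distInt_nonneg θ
  calc ‖(c (N - 1 + 1) : ℂ) • G N - ∑ i ∈ range (N - 1), ((c (i + 1 + 1) : ℂ) - c (i + 1)) • G (i + 1)‖ * (2 * distInt θ)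
      ≤ (‖(c (N - 1 + 1) : ℂ) • G N‖ + ‖∑ i ∈ range (N - 1), ((c (i + 1 + 1) : ℂ) - c (i + 1)) • G (i + 1)‖) *
          (2 * distInt θ) := mul_le_mul_of_nonneg_right (norm_sub_le _ _) (by positivity)
    _ ≤ (|c N| * ‖G N‖ + ∑ i ∈ range (N - 1), |c (i + 1 + 1) - c (i + 1)| * ‖G (i + 1)‖) * (2 * distInt θ) := by
        apply mul_le_mul_of_nonneg_right _ (by positivity)
        apply add_le_add
        · rw [Nat.sub_add_cancel hN, norm_smul, Complex.norm_real, Real.norm_eq_abs]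
        · refine (norm_sum_le _ _).trans (Finset.sum_le_sum fun i _ => ?_)
          rw [norm_smul, ← Complex.ofReal_sub, Complex.norm_real, Real.norm_eq_abs]
    _ = |c N| * (‖G N‖ * distInt θ) * 2 + ∑ i ∈ range (N - 1), |c (i + 1 + 1) - c (i + 1)| * (‖G (i + 1)‖ * distInt θ) * 2 := by
        rw [add_mul, Finset.sum_mul]; congr 1; · ring
        exact Finset.sum_congr rfl fun i _ => by ring
    _ ≤ |c N| * (1 / 2) * 2 + ∑ i ∈ range (N - 1), |c (i + 1 + 1) - c (i + 1)| * (1 / 2) * 2 := by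
        apply add_le_add
        · exact mul_le_mul_of_nonneg_right (mul_le_mul_of_nonneg_left (hGle N) (abs_nonneg _)) (by norm_num)
        · exact Finset.sum_le_sum fun i _ => mul_le_mul_of_nonneg_right
            (mul_le_mul_of_nonneg_left (hGle (i + 1)) (abs_nonneg _)) (by norm_num)
    _ = |c N| + ∑ n ∈ Ico 1 N, |c (n + 1) - c n| := by
        congr 1
        · ring
        · refine Finset.sum_nbij' (fun i => i + 1) (fun n => n - 1) ?_ ?_ ?_ ?_ ?_
          · intro i hi; have := Finset.mem_range.mp hi; exact Finset.mem_Ico.mpr ⟨by omega, by omega⟩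
          · intro n hn; have := Finset.mem_Ico.mp hn; exact Finset.mem_range.mpr (by omega)
          · intro i _; omega
          · intro n hn; have := Finset.mem_Ico.mp hn; omega
          · intro i _; ring

/-! ### The model weights -/

/-- The bump `b_α(v) = v^{α+1} (1 − v)²` on `[0,1]` (so that `b_α(v) = w(v) v^{α−1}`, `w(v) = v²(1−v)²`).
[cite: Harper2016, §5] -/
def bump (α v : ℝ) : ℝ := v ^ (α + 1) * (1 - v) ^ 2

/-- The model weights `m_n = (𝓜/x) b_α(n/x)` for `1 ≤ n ≤ x` (and `0` otherwise). [cite: Harper2016, §5] -/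
def modelWeight (M x α : ℝ) (n : ℕ) : ℝ :=
  if 1 ≤ n ∧ (n : ℝ) ≤ x then M / x * bump α (n / x) else 0

/-- `0 ≤ b_α(v) ≤ 1` on `[0, 1]` (`α ≥ 0`). [folklore] -/
theorem bump_bounds {α v : ℝ} (hα : 0 ≤ α) (hv0 : 0 ≤ v) (hv1 : v ≤ 1) : 0 ≤ bump α v ∧ bump α v ≤ 1 := by
  unfold bump
  have h1 : 0 ≤ v ^ (α + 1) := Real.rpow_nonneg hv0 _
  have h2 : v ^ (α + 1) ≤ 1 := Real.rpow_le_one hv0 hv1 (by linarith)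
  have h3 : (1 - v) ^ 2 ≤ 1 := by nlinarith
  exact ⟨by positivity, by nlinarith [sq_nonneg (1 - v)]⟩

/-- `0 ≤ m_n ≤ 𝓜/x` (`𝓜 ≥ 0`, `x > 0`, `α ≥ 0`). [folklore] -/
theorem modelWeight_bounds {M x α : ℝ} (hM : 0 ≤ M) (hx : 0 < x) (hα : 0 ≤ α) (n : ℕ) :
    0 ≤ modelWeight M x α n ∧ modelWeight M x α n ≤ M / x := by
  unfold modelWeight
  split_ifs with h
  · have hv0 : 0 ≤ (n : ℝ) / x := by positivity
    have hv1 : (n : ℝ) / x ≤ 1 := by rw [div_le_one hx]; exact h.2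
    obtain ⟨b0, b1⟩ := bump_bounds hα hv0 hv1
    exact ⟨by positivity, by nlinarith [div_nonneg hM hx.le]⟩
  · exact ⟨le_rfl, by positivity⟩

/-- `m_n = 0` unless `1 ≤ n ≤ x`. [folklore] -/
theorem modelWeight_eq_zero {M x α : ℝ} {n : ℕ} (h : ¬ (1 ≤ n ∧ (n : ℝ) ≤ x)) : modelWeight M x α n = 0 :=
  if_neg h

/-! ### The bump is Lipschitz -/

/-- `b_α` has derivative `(α+1) v^α (1−v)² − 2 v^{α+1} (1−v)`. [folklore] -/
theorem hasDerivAt_bump {α : ℝ} (hα : 0 ≤ α) (v : ℝ) :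
    HasDerivAt (bump α) ((α + 1) * v ^ α * (1 - v) ^ 2 - 2 * v ^ (α + 1) * (1 - v)) v := by
  show HasDerivAt (fun w : ℝ => w ^ (α + 1) * (1 - w) ^ 2) _ v
  have h1 : HasDerivAt (fun v : ℝ => v ^ (α + 1)) ((α + 1) * v ^ (α + 1 - 1)) v :=
    Real.hasDerivAt_rpow_const (Or.inr (by linarith))
  rw [show α + 1 - 1 = α by ring] at h1
  have h2 : HasDerivAt (fun v : ℝ => (1 - v) ^ 2) (2 * (1 - v) * (-1)) v := by
    have h3 : HasDerivAt (fun w : ℝ => (1 - w) * (1 - w)) (-1 * (1 - v) + (1 - v) * -1) v :=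
      ((hasDerivAt_id v).const_sub 1).fun_mul ((hasDerivAt_id v).const_sub 1)
    have h4 : (fun w : ℝ => (1 - w) ^ 2) = fun w : ℝ => (1 - w) * (1 - w) := by funext w; ring
    rw [h4, show 2 * (1 - v) * (-1 : ℝ) = -1 * (1 - v) + (1 - v) * -1 by ring]
    exact h3
  have h5 := h1.fun_mul h2
  have h6 : (fun w : ℝ => w ^ (α + 1) * (1 - w) ^ 2) = bump α := by funext w; rfl
  rw [show (α + 1) * v ^ α * (1 - v) ^ 2 - 2 * v ^ (α + 1) * (1 - v) =
    (α + 1) * v ^ α * (1 - v) ^ 2 + v ^ (α + 1) * (2 * (1 - v) * (-1)) by ring]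
  exact h5

/-- `|b_α'(v)| ≤ 4` on `[0,1]` (`0 ≤ α ≤ 1`). [folklore] -/
theorem abs_deriv_bump_le {α : ℝ} (hα : 0 ≤ α) (hα1 : α ≤ 1) {v : ℝ} (hv0 : 0 ≤ v) (hv1 : v ≤ 1) :
    |(α + 1) * v ^ α * (1 - v) ^ 2 - 2 * v ^ (α + 1) * (1 - v)| ≤ 4 := by
  have h1 : 0 ≤ v ^ α := Real.rpow_nonneg hv0 _
  have h2 : v ^ α ≤ 1 := Real.rpow_le_one hv0 hv1 hα
  have h3 : 0 ≤ v ^ (α + 1) := Real.rpow_nonneg hv0 _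
  have h4 : v ^ (α + 1) ≤ 1 := Real.rpow_le_one hv0 hv1 (by linarith)
  have h5 : 0 ≤ (1 - v) ^ 2 := sq_nonneg _
  have h6 : (1 - v) ^ 2 ≤ 1 := by nlinarith
  rw [abs_le]
  constructor
  · nlinarith [mul_nonneg (mul_nonneg (by linarith : (0:ℝ) ≤ α + 1) h1) h5, mul_nonneg h3 (by linarith : (0:ℝ) ≤ 1 - v)]
  · nlinarith [mul_le_mul (mul_le_mul_of_nonneg_left h2 (by linarith : (0:ℝ) ≤ α + 1)) h6 h5 (by positivity),
      mul_nonneg h3 (by linarith : (0:ℝ) ≤ 1 - v)]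

/-- **`b_α` is `4`-Lipschitz on `[0,1]`.** [folklore] -/
theorem abs_bump_sub_le {α : ℝ} (hα : 0 ≤ α) (hα1 : α ≤ 1) {u v : ℝ} (hu : u ∈ Set.Icc (0 : ℝ) 1)
    (hv : v ∈ Set.Icc (0 : ℝ) 1) : |bump α u - bump α v| ≤ 4 * |u - v| := by
  have hderiv : ∀ w ∈ Set.Icc (0 : ℝ) 1, DifferentiableAt ℝ (bump α) w := fun w _ => (hasDerivAt_bump hα w).differentiableAt
  have hbound : ∀ w ∈ Set.Icc (0 : ℝ) 1, ‖deriv (bump α) w‖ ≤ 4 := by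
    intro w hw
    rw [(hasDerivAt_bump hα w).deriv, Real.norm_eq_abs]
    exact abs_deriv_bump_le hα hα1 hw.1 hw.2
  have := (convex_Icc (0 : ℝ) 1).norm_image_sub_le_of_norm_deriv_le hderiv hbound hv hu
  rw [Real.norm_eq_abs, Real.norm_eq_abs] at this
  exact this

/-! ### The model exponential sum -/

/-- `M(θ) = ∑_{1 ≤ n ≤ x} m_n e(nθ)`. [cite: Harper2016, §5] -/
def modelSum (M x α θ : ℝ) : ℂ :=
  ∑ n ∈ Icc 1 ⌊x⌋₊, (modelWeight M x α n : ℂ) * (𝐞 (n * θ) : ℂ)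

/-- Variation of the model weights: `∑_{n<N} |m_{n+1} − m_n| ≤ 4 𝓜/x` (`N = ⌊x⌋`). [folklore] -/
theorem sum_abs_modelWeight_sub_le {M x α : ℝ} (hM : 0 ≤ M) (hx : 1 ≤ x) (hα : 0 ≤ α) (hα1 : α ≤ 1) :
    ∑ n ∈ Ico 1 ⌊x⌋₊, |modelWeight M x α (n + 1) - modelWeight M x α n| ≤ 4 * M / x := by
  have hx0 : 0 < x := by linarith
  have hNx : (⌊x⌋₊ : ℝ) ≤ x := Nat.floor_le hx0.le
  have hterm : ∀ n ∈ Ico 1 ⌊x⌋₊, |modelWeight M x α (n + 1) - modelWeight M x α n| ≤ M / x * (4 / x) := by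
    intro n hn
    obtain ⟨hn1, hnN⟩ := Finset.mem_Ico.mp hn
    have hn1x : (n : ℝ) ≤ x := le_trans (by exact_mod_cast hnN.le) hNx
    have hn2x : ((n + 1 : ℕ) : ℝ) ≤ x := le_trans (by exact_mod_cast hnN) hNx
    rw [modelWeight, if_pos ⟨by omega, hn2x⟩, modelWeight, if_pos ⟨hn1, hn1x⟩, ← mul_sub, abs_mul,
      abs_of_nonneg (by positivity)]
    apply mul_le_mul_of_nonneg_left _ (by positivity)
    have hu : ((n + 1 : ℕ) : ℝ) / x ∈ Set.Icc (0 : ℝ) 1 := ⟨by positivity, by rw [div_le_one hx0]; exact hn2x⟩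
    have hv : (n : ℝ) / x ∈ Set.Icc (0 : ℝ) 1 := ⟨by positivity, by rw [div_le_one hx0]; exact hn1x⟩
    refine (abs_bump_sub_le hα hα1 hu hv).trans ?_
    rw [show ((n + 1 : ℕ) : ℝ) / x - n / x = 1 / x by push_cast; field_simp; ring, abs_of_pos (by positivity)]
    rw [mul_one_div]
  calc ∑ n ∈ Ico 1 ⌊x⌋₊, |modelWeight M x α (n + 1) - modelWeight M x α n|
      ≤ ∑ n ∈ Ico 1 ⌊x⌋₊, M / x * (4 / x) := Finset.sum_le_sum hterm
    _ = ((⌊x⌋₊ - 1 : ℕ) : ℝ) * (M / x * (4 / x)) := by rw [Finset.sum_const, Nat.card_Ico, nsmul_eq_mul]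
    _ ≤ x * (M / x * (4 / x)) := by
        apply mul_le_mul_of_nonneg_right _ (by positivity)
        exact le_trans (by exact_mod_cast Nat.sub_le _ _) hNx
    _ = 4 * M / x := by field_simp

/-- **The model sum away from integers**: `‖M(θ)‖ · 2‖θ‖ ≤ 5𝓜/x`. [folklore] -/
theorem norm_modelSum_mul_distInt_le {M x α : ℝ} (hM : 0 ≤ M) (hx : 1 ≤ x) (hα : 0 ≤ α) (hα1 : α ≤ 1) (θ : ℝ) :
    ‖modelSum M x α θ‖ * (2 * distInt θ) ≤ 5 * M / x := by
  have hx0 : 0 < x := by linarith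
  have h := norm_sum_mul_fourierChar_mul_distInt_le (modelWeight M x α) ⌊x⌋₊ θ
  rw [modelSum]
  refine h.trans ?_
  have h1 : |modelWeight M x α ⌊x⌋₊| ≤ M / x := by
    obtain ⟨a, b⟩ := modelWeight_bounds hM hx0 hα ⌊x⌋₊
    rw [abs_of_nonneg a]; exact b
  have h2 := sum_abs_modelWeight_sub_le hM hx hα hα1
  have : M / x + 4 * M / x = 5 * M / x := by ring
  linarith

/-- `∑_{r mod N₀} e(nr/N₀) conj e(n'r/N₀) = N₀ [N₀ ∣ n − n']`. [cite: MontgomeryVaughan2007, §4.1 (4.6)] -/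
theorem sum_fourierChar_pair {N₀ : ℕ} (hN : N₀ ≠ 0) (n n' : ℕ) :
    ∑ r ∈ range N₀, (𝐞 ((n : ℝ) * r / N₀) : ℂ) * conj (𝐞 ((n' : ℝ) * r / N₀) : ℂ) =
      if (N₀ : ℤ) ∣ ((n : ℤ) - n') then (N₀ : ℂ) else 0 := by
  rw [← sum_range_fourierChar_div hN ((n : ℤ) - n')]
  refine Finset.sum_congr rfl fun r _ => ?_
  rw [conj_fourierChar, ← Circle.coe_mul, ← AddChar.map_add_eq_mul]
  congr 2
  push_cast; ring

/-- **Parseval on `ℤ/N₀`** for real coefficients: for `K ≤ N₀`,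
`∑_{r mod N₀} ‖∑_{n=1}^{K} c_n e(nr/N₀)‖² = N₀ ∑_{n=1}^{K} c_n²`. [folklore] -/
theorem parseval_real (c : ℕ → ℝ) {K N₀ : ℕ} (hK : K ≤ N₀) (hN : N₀ ≠ 0) :
    ∑ r ∈ range N₀, ‖∑ n ∈ Icc 1 K, (c n : ℂ) * (𝐞 ((n : ℝ) * r / N₀) : ℂ)‖ ^ 2 = N₀ * ∑ n ∈ Icc 1 K, c n ^ 2 := by
  -- the complex identity `∑_r Z_r conj Z_r = N₀ ∑ c_n²`
  have hC : ∑ r ∈ range N₀, (∑ n ∈ Icc 1 K, (c n : ℂ) * (𝐞 ((n : ℝ) * r / N₀) : ℂ)) *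
      conj (∑ n ∈ Icc 1 K, (c n : ℂ) * (𝐞 ((n : ℝ) * r / N₀) : ℂ)) = (N₀ : ℂ) * ∑ n ∈ Icc 1 K, ((c n ^ 2 : ℝ) : ℂ) := by
    have hexp : ∀ r : ℕ, (∑ n ∈ Icc 1 K, (c n : ℂ) * (𝐞 ((n : ℝ) * r / N₀) : ℂ)) *
        conj (∑ n ∈ Icc 1 K, (c n : ℂ) * (𝐞 ((n : ℝ) * r / N₀) : ℂ)) =
        ∑ n ∈ Icc 1 K, ∑ n' ∈ Icc 1 K, (c n : ℂ) * (c n' : ℂ) *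
          ((𝐞 ((n : ℝ) * r / N₀) : ℂ) * conj (𝐞 ((n' : ℝ) * r / N₀) : ℂ)) := by
      intro r
      rw [map_sum, Finset.sum_mul_sum]
      refine Finset.sum_congr rfl fun n _ => Finset.sum_congr rfl fun n' _ => ?_
      rw [map_mul, Complex.conj_ofReal]; ring
    simp_rw [hexp]
    rw [Finset.sum_comm, Finset.mul_sum]
    refine Finset.sum_congr rfl fun n hn => ?_
    rw [Finset.sum_comm]
    have horth : ∀ n' ∈ Icc 1 K, ∑ r ∈ range N₀, (c n : ℂ) * (c n' : ℂ) *
        ((𝐞 ((n : ℝ) * r / N₀) : ℂ) * conj (𝐞 ((n' : ℝ) * r / N₀) : ℂ)) =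
        if n' = n then (N₀ : ℂ) * ((c n ^ 2 : ℝ) : ℂ) else 0 := by
      intro n' hn'
      rw [← Finset.mul_sum, sum_fourierChar_pair hN n n']
      obtain ⟨hn1, hnN⟩ := Finset.mem_Icc.mp hn
      obtain ⟨hn'1, hn'N⟩ := Finset.mem_Icc.mp hn'
      by_cases heq : n' = n
      · subst heq; simp; ring
      · rw [if_neg, if_neg heq, mul_zero]
        rintro ⟨m, hm⟩
        have h2 : |((n : ℤ) - n')| < N₀ := by rw [abs_lt]; constructor <;> omega
        rw [hm, abs_mul, Nat.abs_cast] at h2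
        have : |m| < 1 := by
          by_contra h3; push Not at h3
          have := mul_le_mul_of_nonneg_left h3 (Nat.cast_nonneg N₀ : (0 : ℤ) ≤ N₀)
          rw [mul_one] at this; omega
        have hm0 : m = 0 := by rcases abs_lt.mp this with ⟨h3, h4⟩; omega
        rw [hm0, mul_zero] at hm
        exact heq (by omega)
    rw [Finset.sum_congr rfl horth, Finset.sum_ite_eq' (Icc 1 K) n, if_pos hn]
  -- take real parts
  have hre : ∀ r : ℕ, (‖∑ n ∈ Icc 1 K, (c n : ℂ) * (𝐞 ((n : ℝ) * r / N₀) : ℂ)‖ ^ 2 : ℝ) =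
      ((∑ n ∈ Icc 1 K, (c n : ℂ) * (𝐞 ((n : ℝ) * r / N₀) : ℂ)) *
        conj (∑ n ∈ Icc 1 K, (c n : ℂ) * (𝐞 ((n : ℝ) * r / N₀) : ℂ))).re := by
    intro r
    rw [Complex.mul_conj, Complex.ofReal_re, Complex.normSq_eq_norm_sq]
  simp_rw [hre]
  rw [← Complex.re_sum, hC]
  have : (N₀ : ℂ) * ∑ n ∈ Icc 1 K, ((c n ^ 2 : ℝ) : ℂ) = (((N₀ : ℝ) * ∑ n ∈ Icc 1 K, c n ^ 2 : ℝ) : ℂ) := by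
    push_cast; rfl
  rw [this, Complex.ofReal_re]

/-- **Parseval for the model**: for `⌊x⌋ ≤ N₀`, `∑_{r mod N₀} ‖M(r/N₀)‖² ≤ N₀ 𝓜²/x`. [folklore] -/
theorem sum_norm_modelSum_sq_le {M x α : ℝ} (hM : 0 ≤ M) (hx : 1 ≤ x) (hα : 0 ≤ α) {N₀ : ℕ} (hN₀ : ⌊x⌋₊ ≤ N₀) :
    ∑ r ∈ range N₀, ‖modelSum M x α (r / N₀)‖ ^ 2 ≤ N₀ * (M ^ 2 / x) := by
  have hx0 : 0 < x := by linarith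
  have hN : N₀ ≠ 0 := by
    intro h0; rw [h0] at hN₀
    have : 1 ≤ ⌊x⌋₊ := Nat.le_floor (by simpa using hx)
    omega
  have h1 : ∑ r ∈ range N₀, ‖modelSum M x α (r / N₀)‖ ^ 2 =
      ∑ r ∈ range N₀, ‖∑ n ∈ Icc 1 ⌊x⌋₊, (modelWeight M x α n : ℂ) * (𝐞 ((n : ℝ) * r / N₀) : ℂ)‖ ^ 2 := by
    refine Finset.sum_congr rfl fun r _ => ?_
    simp only [modelSum, mul_div_assoc]
  rw [h1, parseval_real (modelWeight M x α) hN₀ hN]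
  apply mul_le_mul_of_nonneg_left _ (Nat.cast_nonneg _)
  calc ∑ n ∈ Icc 1 ⌊x⌋₊, modelWeight M x α n ^ 2 ≤ ∑ n ∈ Icc 1 ⌊x⌋₊, (M / x) ^ 2 := by
        refine Finset.sum_le_sum fun n _ => ?_
        obtain ⟨a, b⟩ := modelWeight_bounds hM hx0 hα n
        exact pow_le_pow_left₀ a b 2
    _ = (⌊x⌋₊ : ℝ) * (M / x) ^ 2 := by rw [Finset.sum_const, Nat.card_Icc, nsmul_eq_mul]; simp
    _ ≤ x * (M / x) ^ 2 := mul_le_mul_of_nonneg_right (Nat.floor_le hx0.le) (by positivity)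
    _ = M ^ 2 / x := by field_simp

/-! ### The model sum on the principal arc: comparison with `𝓜 Ŵ_λ(α)` -/

/-- The continuous model integrand `G(t) = b_α(t/x) e(λ t/x)`. [folklore] -/
def modelG (x α lam t : ℝ) : ℂ := (bump α (t / x) : ℂ) * (𝐞 (lam / x * t) : ℂ)

/-- `G` has derivative `b_α'(t/x)/x · e + b_α(t/x) · (2πiλ/x) e`. [folklore] -/
theorem hasDerivAt_modelG {x α : ℝ} (hα : 0 ≤ α) (lam t : ℝ) :
    HasDerivAt (modelG x α lam)
      ((((((α + 1) * (t / x) ^ α * (1 - t / x) ^ 2 - 2 * (t / x) ^ (α + 1) * (1 - t / x)) / x : ℝ)) : ℂ) *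
          (𝐞 ((lam / x : ℝ) * t) : ℂ) +
        (bump α (t / x) : ℂ) * (2 * π * I * ((lam / x : ℝ) : ℂ) * 𝐞 ((lam / x : ℝ) * t))) t := by
  unfold modelG
  have h1 : HasDerivAt (fun t : ℝ => ((bump α (t / x) : ℝ) : ℂ))
      ((((((α + 1) * (t / x) ^ α * (1 - t / x) ^ 2 - 2 * (t / x) ^ (α + 1) * (1 - t / x)) / x : ℝ)) : ℂ)) t := by
    have hb := (hasDerivAt_bump hα (t / x)).comp t ((hasDerivAt_id t).div_const x)
    simp only [Function.comp_def, id] at hb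
    have hb' : HasDerivAt (fun t : ℝ => bump α (t / x))
        (((α + 1) * (t / x) ^ α * (1 - t / x) ^ 2 - 2 * (t / x) ^ (α + 1) * (1 - t / x)) / x) t :=
      hb.congr_deriv (by ring)
    exact hb'.ofReal_comp
  exact h1.mul (hasDerivAt_fourierChar_mul (lam / x) t)

/-- `‖G'(t)‖ ≤ (4 + 2π|λ|)/x` for `t ∈ [0, x]` (`0 ≤ α ≤ 1`). [folklore] -/
theorem norm_deriv_modelG_le {x α : ℝ} (hx : 0 < x) (hα : 0 ≤ α) (hα1 : α ≤ 1) (lam : ℝ) {t : ℝ}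
    (ht : t ∈ Set.Icc (0 : ℝ) x) :
    ‖deriv (modelG x α lam) t‖ ≤ (4 + 2 * π * |lam|) / x := by
  rw [(hasDerivAt_modelG (x := x) hα lam t).deriv]
  have hv0 : 0 ≤ t / x := div_nonneg ht.1 hx.le
  have hv1 : t / x ≤ 1 := by rw [div_le_one hx]; exact ht.2
  have hb := abs_deriv_bump_le hα hα1 hv0 hv1
  obtain ⟨b0, b1⟩ := bump_bounds hα hv0 hv1
  have he : ‖(𝐞 ((lam / x : ℝ) * t) : ℂ)‖ = 1 := Circle.norm_coe _
  calc _ ≤ ‖(((((α + 1) * (t / x) ^ α * (1 - t / x) ^ 2 - 2 * (t / x) ^ (α + 1) * (1 - t / x)) / x : ℝ)) : ℂ) *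
          (𝐞 ((lam / x : ℝ) * t) : ℂ)‖ + ‖(bump α (t / x) : ℂ) * (2 * π * I * ((lam / x : ℝ) : ℂ) * 𝐞 ((lam / x : ℝ) * t))‖ :=
        norm_add_le _ _
    _ ≤ 4 / x + 1 * (2 * π * |lam| / x) := by
        apply add_le_add
        · rw [norm_mul, he, mul_one, Complex.norm_real, Real.norm_eq_abs, abs_div, abs_of_pos hx]
          exact div_le_div_of_nonneg_right hb hx.le
        · rw [norm_mul, norm_mul, he, mul_one, Complex.norm_real, Real.norm_eq_abs, abs_of_nonneg b0]
          apply mul_le_mul b1 _ (norm_nonneg _) zero_le_one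
          have e1 : (2 * π * I * ((lam / x : ℝ) : ℂ) : ℂ) = (((2 * π * (lam / x)) : ℝ) : ℂ) * I := by push_cast; ring
          rw [e1, norm_mul, Complex.norm_I, mul_one, Complex.norm_real, Real.norm_eq_abs, abs_mul, abs_div,
            abs_of_pos hx, abs_of_pos (by positivity : (0:ℝ) < 2 * π)]
          exact le_of_eq (by ring)
    _ = (4 + 2 * π * |lam|) / x := by ring

/-- `G` is `(4 + 2π|λ|)/x`-Lipschitz on `[0, x]` and bounded by `1` there. [folklore] -/
theorem norm_modelG_sub_le {x α : ℝ} (hx : 0 < x) (hα : 0 ≤ α) (hα1 : α ≤ 1) (lam : ℝ) {t u : ℝ}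
    (ht : t ∈ Set.Icc (0 : ℝ) x) (hu : u ∈ Set.Icc (0 : ℝ) x) :
    ‖modelG x α lam u - modelG x α lam t‖ ≤ (4 + 2 * π * |lam|) / x * |u - t| := by
  have h := (convex_Icc (0 : ℝ) x).norm_image_sub_le_of_norm_deriv_le
    (fun v _ => (hasDerivAt_modelG (x := x) hα lam v).differentiableAt)
    (fun v hv => norm_deriv_modelG_le hx hα hα1 lam hv) ht hu
  rwa [Real.norm_eq_abs] at h

/-- `‖G(t)‖ ≤ 1` on `[0, x]`. [folklore] -/
theorem norm_modelG_le {x α : ℝ} (hx : 0 < x) (hα : 0 ≤ α) (lam : ℝ) {t : ℝ} (ht : t ∈ Set.Icc (0 : ℝ) x) :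
    ‖modelG x α lam t‖ ≤ 1 := by
  have hv0 : 0 ≤ t / x := div_nonneg ht.1 hx.le
  have hv1 : t / x ≤ 1 := by rw [div_le_one hx]; exact ht.2
  obtain ⟨b0, b1⟩ := bump_bounds hα hv0 hv1
  rw [modelG, norm_mul, Circle.norm_coe, mul_one, Complex.norm_real, Real.norm_eq_abs, abs_of_nonneg b0]
  exact b1

/-- `G` is continuous. [folklore] -/
theorem continuous_modelG (x : ℝ) {α : ℝ} (hα : 0 ≤ α) (lam : ℝ) : Continuous (modelG x α lam) :=
  continuous_iff_continuousAt.mpr fun t => (hasDerivAt_modelG (x := x) hα lam t).continuousAt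

/-- `x Ŵ_λ(α) = ∫₀ˣ G` (substitution `t = xv`). [folklore] -/
theorem integral_modelG_eq {x α : ℝ} (hx : 0 < x) (lam : ℝ) :
    ∫ t in (0 : ℝ)..x, modelG x α lam t = (x : ℂ) * twistMellin lam α := by
  -- `∫₀ˣ G(t) dt = x ∫₀¹ G(xv) dv`
  have h1 : ∫ t in (0 : ℝ)..x, modelG x α lam t = x • ∫ v in (0 : ℝ)..1, modelG x α lam (x * v) := by
    have := intervalIntegral.smul_integral_comp_mul_left (f := modelG x α lam) (c := x) (a := 0) (b := 1)
    rw [mul_zero, mul_one] at this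
    rw [← this]
  rw [h1, twistMellin, Complex.real_smul]
  congr 1
  refine intervalIntegral.integral_congr fun v hv => ?_
  rw [Set.uIcc_of_le zero_le_one] at hv
  simp only [modelG, bump]
  rw [mul_div_cancel_left₀ _ hx.ne', show ((lam / x : ℝ)) * (x * v) = lam * v by field_simp]
  rw [Complex.ofReal_mul, Complex.ofReal_cpow hv.1]
  push_cast
  ring

set_option maxHeartbeats 800000 in
/-- **The model sum on the principal arc**: for `x ≥ 1`, `0 ≤ α ≤ 1`,
`‖M(λ/x) − 𝓜 Ŵ_λ(α)‖ ≤ (𝓜/x)(5 + 2π|λ|)`. [cite: Harper2016, §5] -/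
theorem norm_modelSum_sub_main_le {M x α : ℝ} (hM : 0 ≤ M) (hx : 1 ≤ x) (hα : 0 ≤ α) (hα1 : α ≤ 1) (lam : ℝ) :
    ‖modelSum M x α (lam / x) - (M : ℂ) * twistMellin lam α‖ ≤ M / x * (5 + 2 * π * |lam|) := by
  have hx0 : 0 < x := by linarith
  set N : ℕ := ⌊x⌋₊ with hN
  have hNx : (N : ℝ) ≤ x := Nat.floor_le hx0.le
  have hxN : x < N + 1 := Nat.lt_floor_add_one x
  set L : ℝ := (4 + 2 * π * |lam|) / x with hL
  have hL0 : 0 ≤ L := by have := Real.pi_pos; positivity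
  -- (i) the model sum is `(M/x) ∑ G(n)`
  have hsum : modelSum M x α (lam / x) = (M / x : ℝ) * ∑ n ∈ Icc 1 N, modelG x α lam n := by
    rw [modelSum, Finset.mul_sum]
    refine Finset.sum_congr rfl fun n hn => ?_
    obtain ⟨hn1, hnN⟩ := Finset.mem_Icc.mp hn
    have hnx : (n : ℝ) ≤ x := le_trans (by exact_mod_cast hnN) hNx
    rw [modelWeight, if_pos ⟨hn1, hnx⟩, modelG]
    push_cast
    rw [show ((lam / x : ℝ)) * (n : ℝ) = n * (lam / x) by ring]
    ring
  -- (ii) the integral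
  have hint := integral_modelG_eq (α := α) hx0 lam
  have hcont := continuous_modelG x hα lam
  have hii : ∀ a b : ℝ, IntervalIntegrable (modelG x α lam) volume a b := fun a b => hcont.intervalIntegrable a b
  -- split `∫₀ˣ = ∫₀ᴺ + ∫_N^x` and `∫₀ᴺ = ∑ ∫_{n-1}^{n}`
  have hsplit : ∫ t in (0 : ℝ)..x, modelG x α lam t =
      (∑ n ∈ Icc 1 N, ∫ t in ((n : ℝ) - 1)..n, modelG x α lam t) + ∫ t in (N : ℝ)..x, modelG x α lam t := by
    rw [← intervalIntegral.integral_add_adjacent_intervals (hii 0 N) (hii N x)]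
    congr 1
    have hadj := intervalIntegral.sum_integral_adjacent_intervals (f := modelG x α lam) (μ := volume)
      (a := fun k : ℕ => (k : ℝ)) (n := N) (fun k _ => hii _ _)
    simp only [Nat.cast_zero] at hadj
    rw [← hadj]
    refine Finset.sum_nbij' (fun k => k + 1) (fun n => n - 1) ?_ ?_ ?_ ?_ ?_
    · intro k hk; have := Finset.mem_range.mp hk; exact Finset.mem_Icc.mpr ⟨by omega, by omega⟩
    · intro n hn; have := Finset.mem_Icc.mp hn; exact Finset.mem_range.mpr (by omega)
    · intro k _; omega
    · intro n hn; have := Finset.mem_Icc.mp hn; omega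
    · intro k _
      push_cast; ring_nf
  -- (iii) each unit interval: `‖G(n) − ∫_{n−1}^{n} G‖ ≤ L`
  have hunit : ∀ n ∈ Icc 1 N, ‖modelG x α lam n - ∫ t in ((n : ℝ) - 1)..n, modelG x α lam t‖ ≤ L := by
    intro n hn
    obtain ⟨hn1, hnN⟩ := Finset.mem_Icc.mp hn
    have hnx : (n : ℝ) ≤ x := le_trans (by exact_mod_cast hnN) hNx
    have hn0 : (1 : ℝ) ≤ n := by exact_mod_cast hn1
    have hle : (n : ℝ) - 1 ≤ n := by linarith
    have hconst : ∫ _ in ((n : ℝ) - 1)..n, modelG x α lam n = modelG x α lam n := by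
      rw [intervalIntegral.integral_const]; simp
    rw [← hconst, ← intervalIntegral.integral_sub intervalIntegrable_const (hii _ _)]
    calc ‖∫ t in ((n : ℝ) - 1)..n, (modelG x α lam n - modelG x α lam t)‖
        ≤ L * |(n : ℝ) - ((n : ℝ) - 1)| := by
          refine intervalIntegral.norm_integral_le_of_norm_le_const fun t ht => ?_
          rw [Set.uIoc_of_le hle] at ht
          have htI : t ∈ Set.Icc (0 : ℝ) x := ⟨by linarith [ht.1], by linarith [ht.2]⟩
          have hnI : (n : ℝ) ∈ Set.Icc (0 : ℝ) x := ⟨by linarith, hnx⟩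
          calc ‖modelG x α lam n - modelG x α lam t‖ ≤ (4 + 2 * π * |lam|) / x * |(n : ℝ) - t| :=
                norm_modelG_sub_le hx0 hα hα1 lam htI hnI
            _ ≤ L * 1 := by rw [hL]; apply mul_le_mul_of_nonneg_left _ hL0; rw [abs_le]; constructor <;> linarith [ht.1, ht.2]
            _ = L := mul_one _
      _ = L := by rw [show (n : ℝ) - ((n : ℝ) - 1) = 1 by ring]; simp
  -- (iv) the tail `‖∫_N^x G‖ ≤ x − N ≤ 1`
  have htail : ‖∫ t in (N : ℝ)..x, modelG x α lam t‖ ≤ 1 := by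
    calc ‖∫ t in (N : ℝ)..x, modelG x α lam t‖ ≤ 1 * |x - N| := by
          refine intervalIntegral.norm_integral_le_of_norm_le_const fun t ht => ?_
          rw [Set.uIoc_of_le hNx] at ht
          exact norm_modelG_le hx0 hα lam ⟨by linarith [ht.1, (Nat.cast_nonneg N : (0:ℝ) ≤ N)], ht.2⟩
      _ ≤ 1 := by rw [abs_of_nonneg (by linarith)]; linarith
  -- assemble
  have hkey : ‖(∑ n ∈ Icc 1 N, modelG x α lam n) - ∫ t in (0 : ℝ)..x, modelG x α lam t‖ ≤ x * L + 1 := by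
    rw [hsplit, show (∑ n ∈ Icc 1 N, modelG x α lam n) -
        ((∑ n ∈ Icc 1 N, ∫ t in ((n : ℝ) - 1)..n, modelG x α lam t) + ∫ t in (N : ℝ)..x, modelG x α lam t) =
        (∑ n ∈ Icc 1 N, (modelG x α lam n - ∫ t in ((n : ℝ) - 1)..n, modelG x α lam t)) -
          ∫ t in (N : ℝ)..x, modelG x α lam t by rw [Finset.sum_sub_distrib]; ring]
    calc _ ≤ ‖∑ n ∈ Icc 1 N, (modelG x α lam n - ∫ t in ((n : ℝ) - 1)..n, modelG x α lam t)‖ +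
          ‖∫ t in (N : ℝ)..x, modelG x α lam t‖ := norm_sub_le _ _
      _ ≤ (∑ n ∈ Icc 1 N, L) + 1 := add_le_add ((norm_sum_le _ _).trans (Finset.sum_le_sum hunit)) htail
      _ = N * L + 1 := by rw [Finset.sum_const, Nat.card_Icc, nsmul_eq_mul]; simp
      _ ≤ x * L + 1 := by nlinarith
  have hx0' : (x : ℂ) ≠ 0 := by exact_mod_cast hx0.ne'
  have hW : twistMellin lam α = (x : ℂ)⁻¹ * ∫ t in (0 : ℝ)..x, modelG x α lam t := by
    rw [hint, ← mul_assoc, inv_mul_cancel₀ hx0', one_mul]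
  have hfac : ((M / x : ℝ) : ℂ) * (∑ n ∈ Icc 1 N, modelG x α lam n) - (M : ℂ) * ((x : ℂ)⁻¹ * ∫ t in (0 : ℝ)..x, modelG x α lam t) =
      ((M / x : ℝ) : ℂ) * ((∑ n ∈ Icc 1 N, modelG x α lam n) - ∫ t in (0 : ℝ)..x, modelG x α lam t) := by
    push_cast; field_simp
  rw [hsum, hW, hfac, norm_mul, Complex.norm_real, Real.norm_eq_abs, abs_of_nonneg (by positivity)]
  calc M / x * ‖(∑ n ∈ Icc 1 N, modelG x α lam n) - ∫ t in (0 : ℝ)..x, modelG x α lam t‖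
      ≤ M / x * (x * L + 1) := mul_le_mul_of_nonneg_left hkey (by positivity)
    _ = M / x * (5 + 2 * π * |lam|) := by rw [hL]; field_simp; ring

/-! ### The model count -/

/-- The model weight is at least `𝓜/(256 x)` on `[x/4, 3x/4]`. [folklore] -/
theorem modelWeight_ge {M x α : ℝ} (hM : 0 ≤ M) (hx : 0 < x) (hα1 : α ≤ 1) {n : ℕ} (hn1 : 1 ≤ n)
    (hlo : x / 4 ≤ n) (hhi : (n : ℝ) ≤ 3 * x / 4) : M / (256 * x) ≤ modelWeight M x α n := by
  have hnx : (n : ℝ) ≤ x := by linarith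
  rw [modelWeight, if_pos ⟨hn1, hnx⟩]
  have hv0 : 1 / 4 ≤ (n : ℝ) / x := by rw [le_div_iff₀ hx]; linarith
  have hv1 : (n : ℝ) / x ≤ 3 / 4 := by rw [div_le_iff₀ hx]; linarith
  set v : ℝ := (n : ℝ) / x with hv
  have hvle1 : v ≤ 1 := by linarith
  have hv0' : 0 < v := by linarith
  -- `b(v) = v^{α+1}(1−v)² ≥ v² (1/4)² ≥ 1/256`
  have h1 : v ^ 2 ≤ v ^ (α + 1) := by
    rw [show v ^ 2 = v ^ ((2 : ℕ) : ℝ) by rw [Real.rpow_natCast]]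
    exact Real.rpow_le_rpow_of_exponent_ge hv0' hvle1 (by push_cast; linarith)
  have h2 : (1 / 4 : ℝ) ^ 2 ≤ (1 - v) ^ 2 := by nlinarith
  have h3 : (1 / 4 : ℝ) ^ 2 ≤ v ^ 2 := by nlinarith
  have hb : 1 / 256 ≤ bump α v := by
    unfold bump
    calc (1 / 256 : ℝ) = (1 / 4) ^ 2 * (1 / 4) ^ 2 := by norm_num
      _ ≤ v ^ (α + 1) * (1 - v) ^ 2 := mul_le_mul (h3.trans h1) h2 (by positivity) (le_trans (by positivity) h1)
  calc M / (256 * x) = M / x * (1 / 256) := by field_simp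
    _ ≤ M / x * bump α v := mul_le_mul_of_nonneg_left hb (by positivity)

/-- **The model count is large**: for `x ≥ 64`, with `m` the model at scale `x` and `m'` at scale
`x/2`: `∑_{1≤a,b≤N₀} m'_a m'_b m_{a+b} ≥ 𝓜'² 𝓜/(2^{28} x)` (`N₀ ≥ 3x/8`). [cite: Harper2016, §5] -/
theorem model_count_ge {M M' x α α' : ℝ} (hM : 0 ≤ M) (hM' : 0 ≤ M') (hx : 64 ≤ x) (hα : 0 ≤ α) (hα1 : α ≤ 1)
    (hα' : 0 ≤ α') (hα1' : α' ≤ 1) {N₀ : ℕ} (hN₀ : 3 * x / 8 ≤ N₀) :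
    M' ^ 2 * M / (2 ^ 28 * x) ≤
      ∑ a ∈ Icc 1 N₀, ∑ b ∈ Icc 1 N₀, modelWeight M' (x / 2) α' a * modelWeight M' (x / 2) α' b * modelWeight M x α (a + b) := by
  have hx0 : 0 < x := by linarith
  -- the good box `A = [⌈x/8⌉, ⌊3x/8⌋]²`
  set A : Finset ℕ := Icc ⌈x / 8⌉₊ ⌊3 * x / 8⌋₊ with hA
  have hAsub : A ⊆ Icc 1 N₀ := by
    intro a ha
    obtain ⟨h1, h2⟩ := Finset.mem_Icc.mp ha
    refine Finset.mem_Icc.mpr ⟨?_, ?_⟩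
    · exact le_trans (Nat.ceil_pos.mpr (by positivity)) h1
    · have : (a : ℝ) ≤ N₀ := le_trans (le_trans (by exact_mod_cast h2) (Nat.floor_le (by positivity))) hN₀
      exact_mod_cast this
  have hmemA : ∀ a ∈ A, 1 ≤ a ∧ x / 8 ≤ a ∧ (a : ℝ) ≤ 3 * x / 8 := by
    intro a ha
    obtain ⟨h1, h2⟩ := Finset.mem_Icc.mp ha
    refine ⟨(Finset.mem_Icc.mp (hAsub ha)).1, le_trans (Nat.le_ceil _) (by exact_mod_cast h1),
      le_trans (by exact_mod_cast h2) (Nat.floor_le (by positivity))⟩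
  -- lower bounds for the weights on the box
  have hm' : ∀ a ∈ A, M' / (256 * (x / 2)) ≤ modelWeight M' (x / 2) α' a := by
    intro a ha
    obtain ⟨h1, h2, h3⟩ := hmemA a ha
    exact modelWeight_ge hM' (by positivity) hα1' h1 (by linarith) (by linarith)
  have hm : ∀ a ∈ A, ∀ b ∈ A, M / (256 * x) ≤ modelWeight M x α (a + b) := by
    intro a ha b hb
    obtain ⟨h1, h2, h3⟩ := hmemA a ha
    obtain ⟨h1', h2', h3'⟩ := hmemA b hb
    exact modelWeight_ge hM hx0 hα1 (by omega) (by push_cast; linarith) (by push_cast; linarith)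
  -- the box has at least `x/8` points on each side
  have hcard : x / 8 ≤ (A.card : ℝ) := by
    rw [hA, Nat.card_Icc]
    have h1 : (⌈x / 8⌉₊ : ℝ) < x / 8 + 1 := Nat.ceil_lt_add_one (by positivity)
    have h2 : 3 * x / 8 - 1 < (⌊3 * x / 8⌋₊ : ℝ) := by have := Nat.lt_floor_add_one (3 * x / 8); linarith
    have h3 : (⌈x / 8⌉₊ : ℝ) ≤ ⌊3 * x / 8⌋₊ + 1 := by linarith
    have h3' : ⌈x / 8⌉₊ ≤ ⌊3 * x / 8⌋₊ + 1 := by exact_mod_cast h3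
    rw [Nat.cast_sub h3']
    push_cast
    linarith
  -- restrict the double sum to the box (all terms are nonnegative)
  have hnonneg : ∀ a b : ℕ, 0 ≤ modelWeight M' (x / 2) α' a * modelWeight M' (x / 2) α' b * modelWeight M x α (a + b) := by
    intro a b
    have h1 := (modelWeight_bounds hM' (by positivity : 0 < x / 2) hα' a).1
    have h2 := (modelWeight_bounds hM' (by positivity : 0 < x / 2) hα' b).1
    have h3 := (modelWeight_bounds hM hx0 hα (a + b)).1
    positivity
  calc M' ^ 2 * M / (2 ^ 28 * x) ≤ (A.card : ℝ) * ((A.card : ℝ) * (M' / (256 * (x / 2)) * (M' / (256 * (x / 2))) * (M / (256 * x)))) := by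
        -- `(x/8)² · (M'/(128x))² · M/(256x) = M'²M/(2^28 x)`
        have h1 : M' ^ 2 * M / (2 ^ 28 * x) = (x / 8) * ((x / 8) * (M' / (256 * (x / 2)) * (M' / (256 * (x / 2))) * (M / (256 * x)))) := by
          field_simp; ring
        rw [h1]
        have hq : 0 ≤ M' / (256 * (x / 2)) * (M' / (256 * (x / 2))) * (M / (256 * x)) := by positivity
        have hq2 : 0 ≤ (x / 8) * (M' / (256 * (x / 2)) * (M' / (256 * (x / 2))) * (M / (256 * x))) := by positivity
        exact mul_le_mul hcard (mul_le_mul_of_nonneg_right hcard hq) hq2 (Nat.cast_nonneg _)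
    _ = ∑ a ∈ A, ∑ b ∈ A, M' / (256 * (x / 2)) * (M' / (256 * (x / 2))) * (M / (256 * x)) := by
        rw [Finset.sum_const, Finset.sum_const, nsmul_eq_mul, nsmul_eq_mul]
    _ ≤ ∑ a ∈ A, ∑ b ∈ A, modelWeight M' (x / 2) α' a * modelWeight M' (x / 2) α' b * modelWeight M x α (a + b) := by
        refine Finset.sum_le_sum fun a ha => Finset.sum_le_sum fun b hb => ?_
        have h1 := hm' a ha; have h2 := hm' b hb; have h3 := hm a ha b hb
        have p1 : 0 ≤ M' / (256 * (x / 2)) := by positivity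
        have p3 : 0 ≤ M / (256 * x) := by positivity
        exact mul_le_mul (mul_le_mul h1 h2 p1 (le_trans p1 h1)) h3 p3 (mul_nonneg (le_trans p1 h1) (le_trans p1 h2))
    _ ≤ ∑ a ∈ Icc 1 N₀, ∑ b ∈ A, modelWeight M' (x / 2) α' a * modelWeight M' (x / 2) α' b * modelWeight M x α (a + b) :=
        Finset.sum_le_sum_of_subset_of_nonneg hAsub fun a _ _ => Finset.sum_nonneg fun b _ => hnonneg a b
    _ ≤ _ := Finset.sum_le_sum fun a _ => Finset.sum_le_sum_of_subset_of_nonneg hAsub fun b _ _ => hnonneg a b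

end Endgame

end Literature.NumberTheory.Sieve

end
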